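import Summits.CriticalPhenomena.PercolationContinuityZ3.Theorems.PercNearOneGluingNoHeavyLowerTailThreePartitionRobustMatching
import Summits.CriticalPhenomena.PercolationContinuityZ3.Theorems.PercNearOneGluingNoHeavyLowerTailThreePartitionVOrderNested

/-!
# `NoHeavyLowerTail` (crux stmt-CriticalPhenomena-4575): CONJECTURE V holds on EVERY NESTED PAIR — the reverse-nested case
# `𝒲 ⊆ 𝒱` via THEOREM A (the one-sided robust three-partition matching), in the tree's `triT` language

Support file (lineage `prim-bnk-2`, generation 25; `--supports stmt-CriticalPhenomena-4575`; memo
`run/shared/lean/prim/prim-l12/FROM-prim-bnk-2-g25-ROBUST-MATCHING.md` §4).  No `sorry`, standard axioms, nothing conditional.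

**THEOREM A in the tree's language (`triT_robust_le`, `triT_robust_le_b`).**  For up-sets `G, H ⊆ 𝒫(ι)`, a twist `τ`, an up-set
`𝒳` of the copy order and ANY side function `σ : 𝒫(ι) → Bool`:
  `#{(a,b)∈𝒳 : c ∈ G, a ∉ H} ≤ #{(a,b)∈𝒳 : c ∉ H, (σ c ? b : a) ∈ G}`   (and the same with source copy `b`),
the counts being the twisted 3-partition counts `triT` of `…ThreePartitionADTwisted` (transfer `triT_eq_card_faces` from the
faces `ι → Fin 3` of `…RobustFaces`).  `σ ≡ a` (source `a`): the column move; source `b` with `σ ≡ a`: Theorem U of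
`…VOrderNested`; general `σ`: the side on which each target layer is tested is chosen by an adversary.

**COROLLARY (`vSumT_nonneg_of_superset`, `vSumT_nonneg_of_nested`).**  `vSumT τ 𝒱 𝒲 𝒳 ≥ 0` whenever `𝒲 ⊆ 𝒱`; with
generation 24's `vSumT_nonneg_of_subset`, **Conjecture V (`VOrderPositivity`) holds for every nested pair, every twist and every
copy-order up-set `𝒳`**.  Proof: for `𝒲 ⊆ 𝒱` the kernel is `K = T2 + J`, `T2 = [a∈𝒱]([a∈𝒲]−[c∈𝒲])` (one column move) and
`J = [a∈𝒲][c∉𝒱] + [c∈𝒱∖𝒲][b∈𝒲] − [c∈𝒲][b∉𝒲]`, which is exactly THEOREM A with source copy `b`, `G = H = 𝒲` and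
`σ(c) = b ⟺ c ∈ 𝒱`.  The general case of Conjecture V (incomparable `𝒱, 𝒲`) remains open. [this work]
-/

namespace Summit.CriticalPhenomena.PercolationContinuityZ3.Theorems.ThreePartition

open Finset Function
open scoped Classical

noncomputable section

variable {ι : Type*} [Fintype ι]

/-! ## Transfer to the tree's twisted three-partition counts `triT` -/

section Transfer

open scoped symmDiff

variable (τ : Set ι)

omit [Fintype ι] in
/-- Every map is a face of the full cube. [this work] -/
theorem mem_faces_univ [Fintype ι] (ω : ι → Fin 3) : ω ∈ faces (Finset.univ : Finset ι) :=
  fun i hi => absurd (Finset.mem_univ i) hi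

omit [Fintype ι] in
/-- On the full cube the twisted copy `j` of `ω` is `{ω = j} ∆ τ`. [this work] -/
theorem cp_univ_eq [Fintype ι] (j : Fin 3) (ω : ι → Fin 3) :
    cp τ (Finset.univ : Finset ι) j ω = {i | ω i = j} ∆ τ := by
  ext i
  simp only [mem_cp, Finset.mem_univ, true_and, Set.mem_symmDiff, Set.mem_setOf_eq]
  tauto

/-- **`triT` as a count of maps `ι → Fin 3`.**  The twisted 3-partition count of the tree equals the number of faces `ω` of the
full cube whose three twisted copies satisfy the predicate. [this work] -/
theorem triT_eq_card_faces (p : Set ι → Set ι → Set ι → Prop) :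
    triT τ p = (Finset.univ.filter fun ω : ι → Fin 3 =>
      p (cp τ Finset.univ 0 ω) (cp τ Finset.univ 1 ω) (cp τ Finset.univ 2 ω)).card := by
  unfold triT tri
  symm
  refine Finset.card_nbij' (fun ω : ι → Fin 3 => (({i | ω i = 0} : Set ι), ({i | ω i = 1} : Set ι)))
    (fun q : Set ι × Set ι => fun i => if i ∈ q.1 then 0 else if i ∈ q.2 then 1 else 2) ?_ ?_ ?_ ?_
  · intro ω hω
    rw [Finset.mem_coe, Finset.mem_filter] at hω ⊢
    refine ⟨Finset.mem_univ _, ?_, ?_⟩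
    · rw [Set.disjoint_left]; intro i (h0 : ω i = 0) (h1 : ω i = 1); rw [h0] at h1; exact absurd h1 (by decide)
    · have h2 : ({i | ω i = 0} ∪ {i | ω i = 1})ᶜ = ({i | ω i = 2} : Set ι) := by
        ext i; simp only [Set.mem_compl_iff, Set.mem_union, Set.mem_setOf_eq, not_or]
        constructor
        · rintro ⟨h0, h1⟩; have h3 : ∀ k : Fin 3, k = 0 ∨ k = 1 ∨ k = 2 := by decide
          rcases h3 (ω i) with h | h | h
          · exact absurd h h0
          · exact absurd h h1
          · exact h
        · intro h; rw [h]; decide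
      show p ({i | ω i = 0} ∆ τ) ({i | ω i = 1} ∆ τ) (({i | ω i = 0} ∪ {i | ω i = 1})ᶜ ∆ τ)
      rw [h2, ← cp_univ_eq, ← cp_univ_eq, ← cp_univ_eq]; exact hω.2
  · intro q hq
    rw [Finset.mem_coe, Finset.mem_filter] at hq ⊢
    refine ⟨Finset.mem_univ _, ?_⟩
    have hd := hq.2.1
    have e0 : cp τ Finset.univ 0 (fun i => if i ∈ q.1 then (0 : Fin 3) else if i ∈ q.2 then 1 else 2) = q.1 ∆ τ := by
      rw [cp_univ_eq]; congr 1; ext i; simp only [Set.mem_setOf_eq]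
      by_cases h1 : i ∈ q.1
      · simp [h1]
      · by_cases h2 : i ∈ q.2 <;> simp [h1, h2]
    have e1 : cp τ Finset.univ 1 (fun i => if i ∈ q.1 then (0 : Fin 3) else if i ∈ q.2 then 1 else 2) = q.2 ∆ τ := by
      rw [cp_univ_eq]; congr 1; ext i; simp only [Set.mem_setOf_eq]
      by_cases h1 : i ∈ q.1
      · have h2 : i ∉ q.2 := fun h => Set.disjoint_left.1 hd h1 h
        simp [h1, h2]
      · by_cases h2 : i ∈ q.2 <;> simp [h1, h2]
    have e2 : cp τ Finset.univ 2 (fun i => if i ∈ q.1 then (0 : Fin 3) else if i ∈ q.2 then 1 else 2) = (q.1 ∪ q.2)ᶜ ∆ τ := by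
      rw [cp_univ_eq]; congr 1; ext i; simp only [Set.mem_setOf_eq, Set.mem_compl_iff, Set.mem_union, not_or]
      by_cases h1 : i ∈ q.1
      · simp [h1]
      · by_cases h2 : i ∈ q.2 <;> simp [h1, h2]
    have hq' : p (q.1 ∆ τ) (q.2 ∆ τ) ((q.1 ∪ q.2)ᶜ ∆ τ) := hq.2.2
    rw [← e0, ← e1, ← e2] at hq'; exact hq'
  · intro ω _
    ext i
    have h3 : ∀ k : Fin 3, k = 0 ∨ k = 1 ∨ k = 2 := by decide
    rcases h3 (ω i) with h | h | h <;> simp [h]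
  · intro q hq
    rw [Finset.mem_coe, Finset.mem_filter] at hq
    have hd := hq.2.1
    ext i
    · simp only [Set.mem_setOf_eq]
      by_cases h1 : i ∈ q.1
      · simp [h1]
      · by_cases h2 : i ∈ q.2 <;> simp [h1, h2]
    · simp only [Set.mem_setOf_eq]
      by_cases h1 : i ∈ q.1
      · have h2 : i ∉ q.2 := fun h => Set.disjoint_left.1 hd h1 h
        simp [h1, h2]
      · by_cases h2 : i ∈ q.2 <;> simp [h1, h2]

/-- **THEOREM A in the tree's language (source side `a`).**  For up-sets `G, H ⊆ 𝒫(ι)`, an up-set `𝒳` of the copy order and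
ANY side function `σ`:  `#{(a,b) ∈ 𝒳 : c ∈ G, a ∉ H} ≤ #{(a,b) ∈ 𝒳 : c ∉ H, σ(c)-copy ∈ G}` (twisted counts, every `τ`).
With `σ ≡ a` this is the column move, with `σ ≡ b` after `triT_swap12` Theorem U (`…VOrderNested`); in general the side on which the
target is tested is chosen by an adversary layer by layer. [this work] -/
theorem triT_robust_le {𝒳 : Set (Set ι × Set ι)} (h𝒳 : IsUpperSet 𝒳) {G H : Set (Set ι)} (hG : IsUpperSet G)
    (hH : IsUpperSet H) (σ : Set ι → Bool) :
    triT τ (fun a b c => (a, b) ∈ 𝒳 ∧ c ∈ G ∧ a ∉ H) ≤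
      triT τ (fun a b c => (a, b) ∈ 𝒳 ∧ c ∉ H ∧ (if σ c then b ∈ G else a ∈ G)) := by
  rw [triT_eq_card_faces, triT_eq_card_faces]
  obtain ⟨f, hf, hfm⟩ := exists_robust_matching τ (Finset.univ : Finset ι) G H hG hH σ
  refine Finset.card_le_card_of_injOn f ?_ ?_
  · intro ω hω
    simp only [Finset.mem_coe, Finset.mem_filter, Finset.mem_univ, true_and] at hω ⊢
    have hN : ω ∈ Nfam τ Finset.univ G H := mem_Nfam.2 ⟨mem_faces_univ ω, hω.2.1, hω.2.2⟩
    have hP : f ω ∈ Pfam τ Finset.univ H G G σ := by exact_mod_cast hf.mapsTo (by exact_mod_cast hN)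
    rw [mem_Pfam] at hP
    have hup := hfm ω hN
    rw [mem_above] at hup
    refine ⟨?_, hP.2.1, hP.2.2⟩
    exact h𝒳 (show ((cp τ Finset.univ 0 ω, cp τ Finset.univ 1 ω) : Set ι × Set ι) ≤
      (cp τ Finset.univ 0 (f ω), cp τ Finset.univ 1 (f ω)) from ⟨hup.1, hup.2⟩) hω.1
  · intro ω₁ hω₁ ω₂ hω₂ h
    simp only [Finset.mem_coe, Finset.mem_filter, Finset.mem_univ, true_and] at hω₁ hω₂
    exact hf.injOn (by exact_mod_cast mem_Nfam.2 ⟨mem_faces_univ ω₁, hω₁.2.1, hω₁.2.2⟩)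
      (by exact_mod_cast mem_Nfam.2 ⟨mem_faces_univ ω₂, hω₂.2.1, hω₂.2.2⟩) h

/-- **THEOREM A in the tree's language, source side `b`** (from the side-`a` version by the slot symmetry `1 ↔ 2`). [this work] -/
theorem triT_robust_le_b {𝒳 : Set (Set ι × Set ι)} (h𝒳 : IsUpperSet 𝒳) {G H : Set (Set ι)} (hG : IsUpperSet G)
    (hH : IsUpperSet H) (σ : Set ι → Bool) :
    triT τ (fun a b c => (a, b) ∈ 𝒳 ∧ c ∈ G ∧ b ∉ H) ≤
      triT τ (fun a b c => (a, b) ∈ 𝒳 ∧ c ∉ H ∧ (if σ c then b ∈ G else a ∈ G)) := by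
  have h𝒳' : IsUpperSet {q : Set ι × Set ι | (q.2, q.1) ∈ 𝒳} := fun _ _ hle hq =>
    h𝒳 (Prod.mk_le_mk.2 ⟨(Prod.mk_le_mk.1 hle).2, (Prod.mk_le_mk.1 hle).1⟩) hq
  have h := triT_robust_le τ h𝒳' hG hH (fun c => !σ c)
  rw [triT_swap12 τ (fun a b c => (a, b) ∈ {q : Set ι × Set ι | (q.2, q.1) ∈ 𝒳} ∧ c ∈ G ∧ a ∉ H),
    triT_swap12 τ (fun a b c => (a, b) ∈ {q : Set ι × Set ι | (q.2, q.1) ∈ 𝒳} ∧ c ∉ H ∧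
      (if (!σ c) = true then b ∈ G else a ∈ G))] at h
  refine le_trans (le_of_eq (triT_congr fun a b c => ?_)) (le_trans h (le_of_eq (triT_congr fun a b c => ?_)))
  · simp only [Set.mem_setOf_eq]
  · simp only [Set.mem_setOf_eq]
    cases σ c <;> simp

end Transfer

/-! ## CONJECTURE V for reverse-nested pairs `𝒲 ⊆ 𝒱` -/

section ReverseNested

open scoped symmDiff

/-- **CONJECTURE V HOLDS FOR REVERSE-NESTED PAIRS `𝒲 ⊆ 𝒱`** (all twists, all up-sets `𝒳` of the copy order): the kernel
sum `vSumT τ 𝒱 𝒲 𝒳` is `≥ 0`.  Proof (memo §4 (C1)): with `𝒲 ⊆ 𝒱`, `K = T2 + J` where `T2 = [a∈𝒱]([a∈𝒲] − [c∈𝒲])` is one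
column move (`triT_col_le`) and `J = [a∈𝒲][c∉𝒱] + [c∈𝒱∖𝒲][b∈𝒲] − [c∈𝒲][b∉𝒲]` is EXACTLY an instance of THEOREM A with
source side `b`, `G = H = 𝒲` and the side function `σ(c) = b` iff `c ∈ 𝒱` (`triT_robust_le_b`).  Together with generation 24's
`vSumT_nonneg_of_subset` (`𝒱 ⊆ 𝒲`), Conjecture V (`VOrderPositivity`) holds on every nested pair. [this work] -/
theorem vSumT_nonneg_of_superset (τ : Set ι) {𝒱 𝒲 : Set (Set ι)} {𝒳 : Set (Set ι × Set ι)}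
    (h𝒱 : IsUpperSet 𝒱) (h𝒲 : IsUpperSet 𝒲) (h𝒳 : IsUpperSet 𝒳) (hsub : 𝒲 ⊆ 𝒱) :
    0 ≤ vSumT τ 𝒱 𝒲 𝒳 := by
  -- notation-free bookkeeping: the five counts
  have e1 : triT τ (fun a b _ => (a, b) ∈ 𝒳 ∧ a ∈ 𝒱 ∧ a ∈ 𝒲) = triT τ (fun a b _ => (a, b) ∈ 𝒳 ∧ a ∈ 𝒲) :=
    triT_congr fun a b c => ⟨fun h => ⟨h.1, h.2.2⟩, fun h => ⟨h.1, hsub h.2, h.2⟩⟩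
  have e5 : triT τ (fun a b c => (a, b) ∈ 𝒳 ∧ c ∈ 𝒱 ∧ c ∈ 𝒲) = triT τ (fun a b c => (a, b) ∈ 𝒳 ∧ c ∈ 𝒲) :=
    triT_congr fun a b c => ⟨fun h => ⟨h.1, h.2.2⟩, fun h => ⟨h.1, hsub h.2, h.2⟩⟩
  -- T2: column move `X(a∈𝒱, c∈𝒲) ≤ X(a∈𝒲)`
  have hT2 : triT τ (fun a b c => (a, b) ∈ 𝒳 ∧ a ∈ 𝒱 ∧ c ∈ 𝒲) ≤ triT τ (fun a b _ => (a, b) ∈ 𝒳 ∧ a ∈ 𝒲) := by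
    have hA : ∀ b : Set ι, IsUpperSet {a : Set ι | (a, b) ∈ 𝒳 ∧ a ∈ 𝒱} := fun b a a' hle ha =>
      ⟨h𝒳 (Prod.mk_le_mk.2 ⟨hle, le_rfl⟩) ha.1, h𝒱 hle ha.2⟩
    have h := triT_col_le τ (fun b => {a : Set ι | (a, b) ∈ 𝒳 ∧ a ∈ 𝒱}) hA h𝒲
    refine le_trans (le_of_eq (triT_congr fun a b c => ?_)) (le_trans h (le_of_eq (triT_congr fun a b c => ?_)))
    · simp only [Set.mem_setOf_eq]; tauto
    · simp only [Set.mem_setOf_eq]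
      exact ⟨fun h => ⟨h.1.1, h.2⟩, fun h => ⟨⟨h.1, hsub h.2⟩, h.2⟩⟩
  -- splittings
  have s1 := triT_and_add_triT_and_not τ (fun a b _ => (a, b) ∈ 𝒳 ∧ a ∈ 𝒲) (fun _ _ c => c ∈ 𝒱)
  have s2 := triT_and_add_triT_and_not τ (fun a b c => (a, b) ∈ 𝒳 ∧ c ∈ 𝒲) (fun _ b _ => b ∈ 𝒲)
  have s3 := triT_and_add_triT_and_not τ (fun a b c => (a, b) ∈ 𝒳 ∧ c ∈ 𝒱 ∧ b ∈ 𝒲) (fun _ _ c => c ∈ 𝒲)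
  have e3 : triT τ (fun a b c => ((a, b) ∈ 𝒳 ∧ c ∈ 𝒱 ∧ b ∈ 𝒲) ∧ c ∈ 𝒲) =
      triT τ (fun a b c => ((a, b) ∈ 𝒳 ∧ c ∈ 𝒲) ∧ b ∈ 𝒲) :=
    triT_congr fun a b c => ⟨fun h => ⟨⟨h.1.1, h.2⟩, h.1.2.2⟩, fun h => ⟨⟨h.1.1, hsub h.1.2, h.2⟩, h.1.2⟩⟩
  have e4 : triT τ (fun a b c => ((a, b) ∈ 𝒳 ∧ a ∈ 𝒲) ∧ c ∈ 𝒱) = triT τ (fun a b c => (a, b) ∈ 𝒳 ∧ a ∈ 𝒲 ∧ c ∈ 𝒱) :=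
    triT_congr fun a b c => by rw [and_assoc]
  -- THEOREM A (side b), `G = H = 𝒲`, `σ(c) = [c ∈ 𝒱]`
  have hA := triT_robust_le_b τ h𝒳 h𝒲 h𝒲 (fun c => decide (c ∈ 𝒱))
  have sA := triT_and_add_triT_and_not τ
    (fun a b c => (a, b) ∈ 𝒳 ∧ c ∉ 𝒲 ∧ (if decide (c ∈ 𝒱) then b ∈ 𝒲 else a ∈ 𝒲)) (fun _ _ c => c ∈ 𝒱)
  have eA1 : triT τ (fun a b c => ((a, b) ∈ 𝒳 ∧ c ∉ 𝒲 ∧ (if decide (c ∈ 𝒱) then b ∈ 𝒲 else a ∈ 𝒲)) ∧ c ∈ 𝒱) =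
      triT τ (fun a b c => ((a, b) ∈ 𝒳 ∧ c ∈ 𝒱 ∧ b ∈ 𝒲) ∧ ¬ c ∈ 𝒲) :=
    triT_congr fun a b c => by
      by_cases hc : c ∈ 𝒱
      · simp [hc]; tauto
      · simp [hc]
  have eA2 : triT τ (fun a b c => ((a, b) ∈ 𝒳 ∧ c ∉ 𝒲 ∧ (if decide (c ∈ 𝒱) then b ∈ 𝒲 else a ∈ 𝒲)) ∧ ¬ c ∈ 𝒱) =
      triT τ (fun a b c => ((a, b) ∈ 𝒳 ∧ a ∈ 𝒲) ∧ ¬ c ∈ 𝒱) :=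
    triT_congr fun a b c => by
      by_cases hc : c ∈ 𝒱
      · simp [hc]
      · have hcW : c ∉ 𝒲 := fun h => hc (hsub h)
        simp [hc, hcW]
  have eN : triT τ (fun a b c => (a, b) ∈ 𝒳 ∧ c ∈ 𝒲 ∧ b ∉ 𝒲) = triT τ (fun a b c => ((a, b) ∈ 𝒳 ∧ c ∈ 𝒲) ∧ ¬ b ∈ 𝒲) :=
    triT_congr fun a b c => by rw [and_assoc]
  rw [eA1, eA2] at sA
  rw [eN] at hA
  rw [e3] at s3
  rw [e4] at s1
  unfold vSumT
  rw [e1, e5]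
  push_cast
  have hT2' := Int.ofNat_le.2 hT2
  have hA' := Int.ofNat_le.2 hA
  have s1' := congrArg (fun n : ℕ => (n : ℤ)) s1
  have s2' := congrArg (fun n : ℕ => (n : ℤ)) s2
  have s3' := congrArg (fun n : ℕ => (n : ℤ)) s3
  have sA' := congrArg (fun n : ℕ => (n : ℤ)) sA
  simp only [Nat.cast_add] at hT2' hA' s1' s2' s3' sA'
  linarith

/-- **Conjecture V on every nested pair** (either `𝒱 ⊆ 𝒲` or `𝒲 ⊆ 𝒱`), all twists, all copy-order up-sets `𝒳`. [this work] -/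
theorem vSumT_nonneg_of_nested (τ : Set ι) {𝒱 𝒲 : Set (Set ι)} {𝒳 : Set (Set ι × Set ι)}
    (h𝒱 : IsUpperSet 𝒱) (h𝒲 : IsUpperSet 𝒲) (h𝒳 : IsUpperSet 𝒳) (h : 𝒱 ⊆ 𝒲 ∨ 𝒲 ⊆ 𝒱) :
    0 ≤ vSumT τ 𝒱 𝒲 𝒳 := by
  rcases h with h | h
  · exact vSumT_nonneg_of_subset τ h𝒱 h𝒲 h𝒳 h
  · exact vSumT_nonneg_of_superset τ h𝒱 h𝒲 h𝒳 h

end ReverseNested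

end

end Summit.CriticalPhenomena.PercolationContinuityZ3.Theorems.ThreePartition
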